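import Mathlib
import HarnessLib

/-!
# Route `KLProgramme`, crux K3 — ENGINE child (stmt-…-19918 → gen-6 engine child, `stub_twoLeg_step` / `stub_twoLeg_scale0`,
# clause (E3a-MS)): THE SLOT FITS AT THE GRADED LEVEL — closed-form slot size ≤ `Q.CE`-keyed budget, given ONE inequality on `Q.CE·G.S₁·Gfr_j`

Cell `gate-hubbard-kl`, seat hubbard-kl-k3c3-p3 (g4) «implicit-function / monotonicity route for μ(n)»; MS-A34 (#42), plan g14 l.2058 / (R17)
(«the ONE inequality the engine's Q-package must satisfy»).  Graded variables: `x = 4^m` (slot), `y = 4^{n₀}` (scale, `n₀ ≥ 1`), `4y ≤ x`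
(`m > n₀`), `0 < U ≤ 1`; slot grading `η ≤ 4Ḡ·U²/x²`, `λ ≤ 2x`, `e₀ ≤ 1923·Gfr₁·U²/(xy)` (Jackson order one at `d = 4^{n₀}`), frame sizes
`A₃ ≤ (4/3)Gfr₃U²y + 600Gfr₀Uy² + (16/3)Gfr₃U²x`, `A₄ ≤ (16/15)Gfr₄U²y² + 3000Gfr₀Uy³ + (64/15)Gfr₄U²x²` (k3c3-p1's `msA3G/msA4G` at `d = y`),
increment-symbol profile `σ1 l ≤ μ_l·U²·(y/4)^{l−2}`, response profile `εm l ≤ ν_l·U²/y·pieceSize`, budget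
`CE·(S1 + S1'U)·U²/y · (Gfr_j·uPow_j·x^{j−2})` (= `msBarQ … n₀ · pieceSize R U m j`).  For each order `j ≤ 4`: the `extSize` closed form of
`…MSFitSizesOsc` is ≤ the budget provided `REQ_j(X, μ, ν, Ḡ, Gfr) ≤ CE·S1·Gfr_j` (`ms_slot_fit_*`; `REQ_j` printed in the statement — the
numerical content of MS-A34 §3 / STATUS 07:11Z, every term shape-checked by the generator).  Method: monotone substitution (`gcongr`), clearing
`x²y³` (`field_simp; ring`), per-monomial domination `Uᵃxᴾyᵠ ≤ w·U⁴xʲy²` (`fit_dom_hi/lo`, `U ≤ 1`, `y ≥ 4`, `x ≥ 4y`), summation.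
THIS FILE: the two monomial-domination lemmas `fit_dom_hi/lo`.  Pure real inequalities; everything PROVED; no definitions, no named facts. [folklore]
-/


noncomputable section

namespace Summit.HubbardSuperconductivity.HubbardSuperconductivity.Theorems.KLRegimeSplit

set_option linter.dupNamespace false -- summit = problem name (single-conjunct summit), D-0017

open Real

/-! ## §0 Monomial domination on the slot region `4 ≤ y`, `4y ≤ x` -/

/-- `xᴾ·y^{a+2} ≤ (1/4)ᵃ(1/16)ᵇ·(x^{P+a+b}·y²)` for `4 ≤ y`, `4y ≤ x`. [folklore] -/
theorem fit_dom_hi {x y : ℝ} (hy : 4 ≤ y) (hyx : 4 * y ≤ x) {P Q j a b : ℕ} (ha : Q = a + 2) (hb : j = P + a + b) :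
    x ^ P * y ^ Q ≤ (1 / 4) ^ a * (1 / 16) ^ b * (x ^ j * y ^ 2) := by
  subst ha; subst hb
  have hy0 : 0 ≤ y := by linarith
  have hx0 : 0 ≤ x := by linarith
  have h1 : y ^ a ≤ (1 / 4 * x) ^ a := pow_le_pow_left₀ hy0 (by linarith) a
  have h2 : (1 : ℝ) ≤ (1 / 16 * x) ^ b := one_le_pow₀ (by linarith)
  have h3 : 0 ≤ x ^ P * y ^ 2 * (1 / 4 * x) ^ a := by positivity
  calc x ^ P * y ^ (a + 2) = x ^ P * y ^ 2 * y ^ a * 1 := by ring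
    _ ≤ x ^ P * y ^ 2 * (1 / 4 * x) ^ a * (1 / 16 * x) ^ b :=
        mul_le_mul (mul_le_mul_of_nonneg_left h1 (by positivity)) h2 zero_le_one h3
    _ = (1 / 4) ^ a * (1 / 16) ^ b * (x ^ (P + a + b) * y ^ 2) := by rw [mul_pow, mul_pow]; ring

/-- `xᴾ·yᵠ ≤ (1/4)ᶜ(1/16)ᵇ·(x^{P+b}·y²)` for `Q + c = 2`, `4 ≤ y`, `16 ≤ x`. [folklore] -/
theorem fit_dom_lo {x y : ℝ} (hy : 4 ≤ y) (hyx : 4 * y ≤ x) {P Q j b c : ℕ} (hc : Q + c = 2) (hb : j = P + b) :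
    x ^ P * y ^ Q ≤ (1 / 4) ^ c * (1 / 16) ^ b * (x ^ j * y ^ 2) := by
  subst hb
  have hy0 : 0 ≤ y := by linarith
  have hx0 : 0 ≤ x := by linarith
  have h1 : (1 : ℝ) ≤ (1 / 4 * y) ^ c := one_le_pow₀ (by linarith)
  have h2 : (1 : ℝ) ≤ (1 / 16 * x) ^ b := one_le_pow₀ (by linarith)
  have h12 : (1 : ℝ) ≤ (1 / 4 * y) ^ c * (1 / 16 * x) ^ b := one_le_mul_of_one_le_of_one_le h1 h2
  have hQ : y ^ 2 = y ^ Q * y ^ c := by rw [← pow_add, hc]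
  calc x ^ P * y ^ Q = x ^ P * y ^ Q * 1 := by ring
    _ ≤ x ^ P * y ^ Q * ((1 / 4 * y) ^ c * (1 / 16 * x) ^ b) := mul_le_mul_of_nonneg_left h12 (by positivity)
    _ = (1 / 4) ^ c * (1 / 16) ^ b * (x ^ (P + b) * (y ^ Q * y ^ c)) := by rw [mul_pow, mul_pow]; ring
    _ = (1 / 4) ^ c * (1 / 16) ^ b * (x ^ (P + b) * y ^ 2) := by rw [hQ]


end Summit.HubbardSuperconductivity.HubbardSuperconductivity.Theorems.KLRegimeSplit

end
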